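import Mathlib.Analysis.SpecialFunctions.Complex.Log
import Literature.NumberTheory.Automorphic.AutomorphicFormsGKModuleProofs
import Literature.NumberTheory.Automorphic.GKModulesOneParameter
import Literature.NumberTheory.Automorphic.AutomorphyDatumGLRegular
import Literature.NumberTheory.Automorphic.AutomorphicRepsGL
import Literature.NumberTheory.Automorphic.ArchimedeanGLn
import HarnessLib

/-!
# `𝔲(n)`-finiteness and integrality of the torus weights at a complex place
(crux `IrreducibilityBySelfDuality.RegularTwistCM`, item stmt-Langlands-14069, line
`petersson-hermitian-purity`, stub `stub_compactPlaceIntegrality`)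

Let `π = W / W'` be an automorphic representation datum on `GL_n(𝔸_K)` in the Borel–Jacquet model
of the tree (`AutomorphicRepData (AutomorphyDatum.gl n K hcpt)`), with Lie algebra action
`ρ𝔤 : 𝔤 = 𝔤𝔩_n(K_∞) → End (W / W')` (`π.HasLieAction ρ𝔤`), and let `w` be a complex place of `K`.
Write `ρ_w := ρ𝔤 ∘ (𝔤𝔩_n(ℂ) = 𝔤𝔩_n(K_w) ↪ 𝔤𝔩_n(K_∞))` for the restriction of `ρ𝔤` to the factor at
`w` (`complexPlaceLie n w`, transported along `LieSubalgebra.topEquiv` exactly as in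
`AutomorphicRepData.HasArchParameter`).  We prove (`stub_compactPlaceIntegrality`):

* (local finiteness on `𝔲(n)`) every `v ∈ W / W'` lies in a finite-dimensional subspace `F` with
  `ρ_w(Y) F ⊆ F` for all skew-Hermitian `Y ∈ 𝔤𝔩_n(ℂ)`;
* (integrality) if `ρ_w(i E_{jj}) v = μ v` with `v ≠ 0` then `μ ∈ iℤ`.

Proof.  `W / W'` with `(π.kRep, ρ𝔤)` is a `(𝔤, K_∞)`-module
(`AutomorphicRepData.isGKModule_of_hasLieAction_holds` with `AutomorphyDatum.isRegular_gl`;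
Borel–Jacquet 1979, 4.6; Wallach, *Real Reductive Groups I*, §3.3.1).  For `Y` skew-Hermitian the
matrix `X = complexPlaceLie n w Y ∈ 𝔤𝔩_n(K_∞)` (entries `(0, δ_w Y_{ab})`) is skew-Hermitian, i.e.
`X ∈ 𝔨 = Lie K_∞`, and `ρ_w(Y) = ρ𝔤(X)`.  (a) Take `F` = the span of the `K_∞`-orbit of `v`: it is
finite-dimensional (`K`-finiteness), contains `v`, is `K_∞`-stable, hence stable under the
one-parameter groups `exp tX ⊆ K_∞` and so under `ρ𝔤(X)` (`IsGKModule.apply_mem_of_expK_stable`).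
(b) For `Y = i E_{jj}` the matrix `2π X` is diagonal with the single non-zero entry
`(0, δ_w 2πi)` at `(j, j)`, so `exp (2π X) = 1` in `K_∞` (`Matrix.exp_diagonal`, `e^{2πi} = 1`), and
`IsGKModule.exp_mul_eq_one_of_eigenvector` gives `e^{2π μ} = 1`, i.e. `μ ∈ iℤ`.

References: A. Borel, H. Jacquet, *Automorphic forms and automorphic representations*, Corvallis
1979, 4.6 [BorelJacquetCorvallis1979]; N. R. Wallach, *Real Reductive Groups I* (1988), §3.3.1
[WallachRRG1]; A. W. Knapp, *Lie Groups Beyond an Introduction* (2002), I.§1, I.§17 [Knapp2002].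
-/

open scoped Classical Matrix ComplexConjugate
open NumberField NumberField.InfinitePlace NumberField.mixedEmbedding
open Literature.NumberTheory.Automorphic

-- `Summit.Langlands.Langlands.…` (problem = summit name, D-0017 layout) trips `dupNamespace` on
-- every declaration; the lakefile sets the same option for the `Summits` library.
set_option linter.dupNamespace false

-- Mathlib idiom (Mathlib/Algebra/Lie/OfAssociative.lean), as in `ArchimedeanGLn`: commutator
-- brackets on matrix algebras and on `Module.End`.
attribute [local instance 100] LieRing.ofAssociativeRing

noncomputable section

namespace Summit.Langlands.Langlands.Theorems.RegularTwistCM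

variable {n : ℕ} {K : Type} [Field K] [NumberField K]

/-! ### The complex-place inclusion preserves skew-Hermitian matrices -/

omit [NumberField K] in
/-- The inclusion `ℂ = K_w ↪ K_∞` of the factor at a complex place commutes with `star`
(complex conjugation on `ℂ`, componentwise `(id, conj)` on `K_∞ = ℝ^{r₁} × ℂ^{r₂}`). [folklore] -/
theorem complexPlaceHom_star (w : {w : InfinitePlace K // w.IsComplex}) (z : ℂ) :
    complexPlaceHom w (star z) = star (complexPlaceHom w z) := by
  rw [complexPlaceHom_apply, complexPlaceHom_apply, Prod.star_def, star_zero, Pi.single_star]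

omit [NumberField K] in
/-- The inclusion `𝔤𝔩_n(ℂ) = 𝔤𝔩_n(K_w) ↪ 𝔤𝔩_n(K_∞)` at a complex place commutes with the conjugate
transpose. [folklore] -/
theorem conjTranspose_complexPlaceLie (w : {w : InfinitePlace K // w.IsComplex})
    (Y : Matrix (Fin n) (Fin n) ℂ) :
    (complexPlaceLie n w Y)ᴴ = complexPlaceLie n w Yᴴ := by
  change ((Y.map (complexPlaceHom w))ᴴ : Matrix (Fin n) (Fin n) (mixedSpace K)) =
    Yᴴ.map (complexPlaceHom w)
  rw [Matrix.conjTranspose_map (complexPlaceHom w) (complexPlaceHom_star w)]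

/-- A skew-Hermitian `Y ∈ 𝔤𝔩_n(ℂ)` is carried by the complex-place inclusion into
`𝔨 = 𝔤 ∩ 𝔲(n, K_∞)`, the Lie algebra of `K_∞` (`𝔤 = 𝔤𝔩_n(K_∞)` is everything for the `GL_n`
datum). Knapp 2002, I.§1, Example (2). [folklore] -/
theorem complexPlaceLie_mem_compactLie {hcpt : isCompact_glFiniteIntegralLevel n K}
    (w : {w : InfinitePlace K // w.IsComplex}) {Y : Matrix (Fin n) (Fin n) ℂ} (hY : Yᴴ = -Y) :
    complexPlaceLie n w Y ∈ (AutomorphyDatum.gl n K hcpt).arch.compactLie := by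
  rw [RealMatrixGroup.mem_compactLie_iff]
  refine ⟨?_, ?_⟩
  · rw [AutomorphyDatum.gl_arch, archGroupGL_lie]
    trivial
  · rw [Matrix.star_eq_conjTranspose, conjTranspose_complexPlaceLie, hY, map_neg]

/-- `i E_{jj} ∈ 𝔤𝔩_n(ℂ)` is skew-Hermitian. [folklore] -/
theorem conjTranspose_I_smul_single (j : Fin n) :
    (Complex.I • Matrix.single j j (1 : ℂ))ᴴ = -(Complex.I • Matrix.single j j (1 : ℂ)) := by
  rw [Matrix.conjTranspose_smul, Matrix.conjTranspose_single, star_one, Complex.star_def,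
    Complex.conj_I, neg_smul]

/-! ### The restriction `ρ_w` on `𝔲(n)` is `ρ𝔤` on `𝔨` -/

/-- For `X ∈ 𝔨`, `ρ𝔤` at the inclusion `𝔨 ↪ 𝔤` of `X` is `ρ𝔤` transported along
`LieSubalgebra.topEquiv` at `X` (both are `ρ𝔤 ⟨X, _⟩`, `𝔤 = ⊤`). [folklore] -/
theorem apply_inclusion_eq_comp_topEquiv_symm {hcpt : isCompact_glFiniteIntegralLevel n K}
    {V : Type*} [AddCommGroup V] [Module ℂ V]
    (ρ𝔤 : (AutomorphyDatum.gl n K hcpt).arch.lie →ₗ⁅ℝ⁆ Module.End ℂ V)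
    {X : Matrix (Fin n) (Fin n) (mixedSpace K)}
    (hX : X ∈ (AutomorphyDatum.gl n K hcpt).arch.compactLie) :
    ρ𝔤 (LieSubalgebra.inclusion (AutomorphyDatum.gl n K hcpt).arch.compactLie_le_lie ⟨X, hX⟩) =
      (ρ𝔤.comp (LieSubalgebra.topEquiv :
        (⊤ : LieSubalgebra ℝ (Matrix (Fin n) (Fin n) (mixedSpace K))) ≃ₗ⁅ℝ⁆
          Matrix (Fin n) (Fin n) (mixedSpace K)).symm.toLieHom) X :=
  rfl

/-! ### `exp (2π i E_{jj}) = 1` in `K_∞` -/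

/-- `exp (0, δ_w 2πi) = 1` in `K_∞ = ℝ^{r₁} × ℂ^{r₂}` (componentwise exponential; `e^{2πi} = 1`).
[folklore] -/
theorem exp_two_pi_smul_complexPlaceHom_I (w : {w : InfinitePlace K // w.IsComplex}) :
    NormedSpace.exp ((2 * Real.pi) • (complexPlaceHom w Complex.I : mixedSpace K)) = 1 := by
  rw [complexPlaceHom_apply, Prod.smul_mk, smul_zero, ← Pi.single_smul]
  refine Prod.ext ?_ ?_
  · rw [Prod.fst_exp, Prod.fst_one, NormedSpace.exp_zero]
  · rw [Prod.snd_exp, Prod.snd_one]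
    funext w'
    rw [Pi.coe_exp, Pi.one_apply]
    dsimp only
    rcases eq_or_ne w' w with rfl | hw
    · rw [Pi.single_eq_same, Complex.real_smul, Complex.ofReal_mul, Complex.ofReal_ofNat]
      have h2 := congrFun Complex.exp_eq_exp_ℂ (2 * ↑Real.pi * Complex.I)
      rw [Complex.exp_two_pi_mul_I] at h2
      exact h2.symm
    · rw [Pi.single_eq_of_ne hw, NormedSpace.exp_zero]

omit [NumberField K] in
/-- `2π · (i E_{jj})`, pushed into `𝔤𝔩_n(K_∞)` at the complex place `w`, is the diagonal matrix
with the single non-zero entry `2π · (0, δ_w i)` at `(j, j)`. [folklore] -/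
theorem two_pi_smul_complexPlaceLie_I_smul_single (w : {w : InfinitePlace K // w.IsComplex})
    (j : Fin n) :
    (2 * Real.pi) • complexPlaceLie n w (Complex.I • Matrix.single j j (1 : ℂ)) =
      Matrix.diagonal
        (Pi.single j ((2 * Real.pi) • (complexPlaceHom w Complex.I : mixedSpace K))) := by
  rw [Matrix.smul_single, smul_eq_mul, mul_one]
  change (2 * Real.pi) • ((Matrix.single j j Complex.I).map (complexPlaceHom w) :
      Matrix (Fin n) (Fin n) (mixedSpace K)) = _
  rw [Matrix.map_single, Matrix.smul_single, Matrix.diagonal_single]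

/-- **`exp (2π · i E_{jj}) = 1` in `GL_n(K_∞)`** (the matrix is diagonal, `Matrix.exp_diagonal`,
and `e^{2πi} = 1`). Knapp 2002, 0.§2. [folklore] -/
theorem exp_two_pi_smul_complexPlaceLie_I_smul_single (w : {w : InfinitePlace K // w.IsComplex})
    (j : Fin n) :
    NormedSpace.exp ((2 * Real.pi) • complexPlaceLie n w (Complex.I • Matrix.single j j (1 : ℂ))) =
      (1 : Matrix (Fin n) (Fin n) (mixedSpace K)) := by
  rw [two_pi_smul_complexPlaceLie_I_smul_single, Matrix.exp_diagonal, ← Matrix.diagonal_one]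
  congr 1
  funext i
  rw [Pi.coe_exp]
  rcases eq_or_ne i j with rfl | hij
  · rw [Pi.single_eq_same, exp_two_pi_smul_complexPlaceHom_I]
  · rw [Pi.single_eq_of_ne hij, NormedSpace.exp_zero]

/-- **`exp (2π · i E_{jj}) = 1` in `K_∞`**, for the one-parameter subgroup `RealMatrixGroup.expK` of
the archimedean group of the `GL_n` datum. Knapp 2002, 0.§2 and I.§17. [folklore] -/
theorem expK_two_pi_smul_eq_one {hcpt : isCompact_glFiniteIntegralLevel n K}
    (w : {w : InfinitePlace K // w.IsComplex}) (j : Fin n)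
    (hX : complexPlaceLie n w (Complex.I • Matrix.single j j (1 : ℂ)) ∈
      (AutomorphyDatum.gl n K hcpt).arch.compactLie) :
    (AutomorphyDatum.gl n K hcpt).arch.expK ((2 * Real.pi) • ⟨_, hX⟩) = 1 := by
  refine Subtype.ext (Units.ext ?_)
  rw [RealMatrixGroup.coe_expK, coe_expGL]
  change NormedSpace.exp
      ((2 * Real.pi) • complexPlaceLie n w (Complex.I • Matrix.single j j (1 : ℂ))) =
    (1 : Matrix (Fin n) (Fin n) (mixedSpace K))
  exact exp_two_pi_smul_complexPlaceLie_I_smul_single w j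

/-! ### The stub -/

set_option maxHeartbeats 400000 in
/-- **C3 (`K`-types at a complex place, any `n`; Borel–Jacquet 1979, 4.6 with Wallach §3.3.1):**
for an automorphic datum `π = W / W'` on `GL_n(𝔸_K)` with Lie algebra action `ρ𝔤` and a complex
place `w`, the restriction `ρ_w` of `ρ𝔤` to `𝔤𝔩_n(ℂ) = 𝔤𝔩_n(K_w)` is locally finite on `𝔲(n)`
(every vector lies in a finite-dimensional subspace stable under the skew-Hermitian matrices) and
`ρ_w (i E_{jj})` has its eigenvalues in `iℤ` (`exp (2π i E_{jj}) = 1` in `U(n) ⊆ K_∞`).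
[cite: BorelJacquetCorvallis1979, 4.6] -/
theorem stub_compactPlaceIntegrality {n : ℕ} {K : Type} [Field K] [NumberField K]
    {hcpt : isCompact_glFiniteIntegralLevel n K}
    (π : AutomorphicRepData (AutomorphyDatum.gl n K hcpt))
    {ρ𝔤 : (AutomorphyDatum.gl n K hcpt).arch.lie →ₗ⁅ℝ⁆ Module.End ℂ π.Quot} (hρ : π.HasLieAction ρ𝔤)
    (w : {w : InfinitePlace K // w.IsComplex}) :
    (∀ v : π.Quot, ∃ F : Submodule ℂ π.Quot, v ∈ F ∧ FiniteDimensional ℂ F ∧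
        ∀ Y : Matrix (Fin n) (Fin n) ℂ, Yᴴ = -Y → ∀ x ∈ F,
          (ρ𝔤.comp (LieSubalgebra.topEquiv : (⊤ : LieSubalgebra ℝ (Matrix (Fin n) (Fin n) (mixedSpace K)))
              ≃ₗ⁅ℝ⁆ Matrix (Fin n) (Fin n) (mixedSpace K)).symm.toLieHom).comp (complexPlaceLie n w) Y x ∈ F) ∧
      (∀ (j : Fin n) (μ : ℂ) (v : π.Quot), v ≠ 0 →
        (ρ𝔤.comp (LieSubalgebra.topEquiv : (⊤ : LieSubalgebra ℝ (Matrix (Fin n) (Fin n) (mixedSpace K)))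
            ≃ₗ⁅ℝ⁆ Matrix (Fin n) (Fin n) (mixedSpace K)).symm.toLieHom).comp (complexPlaceLie n w)
          (Complex.I • Matrix.single j j (1 : ℂ)) v = μ • v → ∃ k : ℤ, μ = k * Complex.I) := by
  -- `W / W'` is a `(𝔤, K_∞)`-module
  have hGK : IsGKModule (AutomorphyDatum.gl n K hcpt).arch π.kRep ρ𝔤 :=
    π.isGKModule_of_hasLieAction_holds (AutomorphyDatum.isRegular_gl hcpt) hρ
  refine ⟨fun v ↦ ?_, fun j μ v hv0 hv ↦ ?_⟩
  · -- (a) local finiteness: the span of the `K_∞`-orbit of `v`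
    let F : Submodule ℂ π.Quot :=
      Submodule.span ℂ (Set.range fun k : (AutomorphyDatum.gl n K hcpt).arch.maximalCompact ↦
        π.kRep k v)
    haveI hF : FiniteDimensional ℂ F := hGK.kFinite v
    have hvF : v ∈ F := by
      have h1 : π.kRep 1 v = v := by rw [map_one, Module.End.one_apply]
      exact Submodule.subset_span ⟨1, h1⟩
    have hFK : ∀ (k : (AutomorphyDatum.gl n K hcpt).arch.maximalCompact), ∀ u ∈ F,
        π.kRep k u ∈ F := by
      intro k u hu
      induction hu using Submodule.span_induction with
      | mem x hx =>
        obtain ⟨k', rfl⟩ := hx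
        rw [← Module.End.mul_apply, ← map_mul]
        exact Submodule.subset_span ⟨k * k', rfl⟩
      | zero => rw [map_zero]; exact zero_mem _
      | add x y _ _ hx hy => rw [map_add]; exact add_mem hx hy
      | smul a x _ hx => rw [map_smul]; exact Submodule.smul_mem _ _ hx
    refine ⟨F, hvF, hF, fun Y hY x hx ↦ ?_⟩
    have key := hGK.apply_mem_of_expK_stable
      ⟨complexPlaceLie n w Y, complexPlaceLie_mem_compactLie w hY⟩ (fun t u hu ↦ hFK _ u hu) hx
    rw [apply_inclusion_eq_comp_topEquiv_symm] at key
    exact key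
  · -- (b) integrality: `exp (2π i E_{jj}) = 1` in `K_∞`
    have hX : complexPlaceLie n w (Complex.I • Matrix.single j j (1 : ℂ)) ∈
        (AutomorphyDatum.gl n K hcpt).arch.compactLie :=
      complexPlaceLie_mem_compactLie w (conjTranspose_I_smul_single j)
    have hv' : ρ𝔤 (LieSubalgebra.inclusion (AutomorphyDatum.gl n K hcpt).arch.compactLie_le_lie
        ⟨_, hX⟩) v = μ • v := by
      rw [apply_inclusion_eq_comp_topEquiv_symm]
      exact hv
    have h1 := hGK.exp_mul_eq_one_of_eigenvector ⟨_, hX⟩ hv' hv0 (expK_two_pi_smul_eq_one w j hX)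
    obtain ⟨k, hk⟩ := Complex.exp_eq_one_iff.1 h1
    refine ⟨k, ?_⟩
    have h2π : ((2 * Real.pi : ℝ) : ℂ) ≠ 0 := by
      exact_mod_cast (mul_pos two_pos Real.pi_pos).ne'
    refine mul_right_cancel₀ h2π ?_
    rw [hk]
    push_cast
    ring

end Summit.Langlands.Langlands.Theorems.RegularTwistCM

end
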